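import Mathlib
import Literature.Geometry.Lorentzian.ReggeWheelerChannels
import Literature.Geometry.Lorentzian.ReggeWheelerTortoise

/-!
# The straightening variable `y = r/√(1 − 2M/r)` for the Regge–Wheeler potentials

In the variable `y := ρ/√(1 − 2M/ρ)` (a function of the area radius `ρ > 2M`) the spin-`s`
Regge–Wheeler potential is EXACTLY an inverse-square potential plus a sub-leading term,

  `V_{s,ℓ}(ρ) = ℓ(ℓ+1)/y² + b`,  `b = (1 − 2M/ρ)(1 − s²)·2M/ρ³`,  `b·y² = (1 − s²)·2M/ρ`

(`rwPotential_eq_strRadius`, `strSource_mul_sq`), and along the tortoise line `dr/dx = 1 − 2M/r` one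
has `dy/dx = (1 − 3M/r)/√(1 − 2M/r) = 1 − ε` (`hasDerivAt_strRadius_comp`) with the *defect*
`ε = strDefect M r` satisfying, for `r ≥ 3M`,

  `2M/r ≤ ε ≤ 2M/r + 3M²/r²`,  `0 < ε ≤ 1`  (`strDefect_ge`, `strDefect_le`, `strDefect_pos`,
  `strDefect_le_one`), and `r ≤ y` (`le_strRadius`).

So on the far side the only deviation of the Regge–Wheeler family from an exactly peelable
inverse-square potential is the small, sign-definite speed defect `ε` of the straightening variable;
this is the normal form used for the peeled residual (route PhotonSphereChannels, stub R).
[folklore]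
-/

noncomputable section

open Set

namespace Literature.Geometry.Lorentzian

namespace ReggeWheeler

/-- The **straightening variable** `y(ρ) = ρ/√(1 − 2M/ρ)` (`y² = ρ³/(ρ − 2M)`). [folklore] -/
def strRadius (M ρ : ℝ) : ℝ := ρ / Real.sqrt (1 - 2 * M / ρ)

/-- The **speed defect** `ε(ρ) = 1 − (1 − 3M/ρ)/√(1 − 2M/ρ)` of the straightening variable:
`dy/dx = 1 − ε` along the tortoise line. [folklore] -/
def strDefect (M ρ : ℝ) : ℝ := 1 - (1 - 3 * M / ρ) / Real.sqrt (1 - 2 * M / ρ)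

/-- The sub-leading **source** `b(ρ) = (1 − 2M/ρ)(1 − s²)·2M/ρ³` of the potential in the straightening
variable. [folklore] -/
def strSource (M : ℝ) (s : ℕ) (ρ : ℝ) : ℝ :=
  (1 - 2 * M / ρ) * ((1 - (s : ℝ) ^ 2) * (2 * M) / ρ ^ 3)

section basic

variable {M ρ : ℝ}

/-- `1 − 2M/ρ > 0` for `ρ > 2M ≥ 0`. [folklore] -/
theorem one_sub_pos (hM : 0 ≤ M) (hρ : 2 * M < ρ) : 0 < 1 - 2 * M / ρ := by
  have hρ0 : 0 < ρ := by linarith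
  rw [_root_.sub_pos, div_lt_one hρ0]
  exact hρ

/-- `(√(1 − 2M/ρ))² = 1 − 2M/ρ` and `√(1 − 2M/ρ) > 0` for `ρ > 2M ≥ 0`. [folklore] -/
theorem sqrt_one_sub_sq (hM : 0 ≤ M) (hρ : 2 * M < ρ) :
    Real.sqrt (1 - 2 * M / ρ) ^ 2 = 1 - 2 * M / ρ ∧ 0 < Real.sqrt (1 - 2 * M / ρ) :=
  ⟨Real.sq_sqrt (one_sub_pos hM hρ).le, Real.sqrt_pos.2 (one_sub_pos hM hρ)⟩

/-- `y² · (1 − 2M/ρ) = ρ²`. [folklore] -/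
theorem strRadius_sq_mul (hM : 0 ≤ M) (hρ : 2 * M < ρ) :
    strRadius M ρ ^ 2 * (1 - 2 * M / ρ) = ρ ^ 2 := by
  obtain ⟨ht2, ht⟩ := sqrt_one_sub_sq hM hρ
  unfold strRadius
  rw [div_pow, ht2, div_mul_cancel₀]
  exact (one_sub_pos hM hρ).ne'

/-- `y² = ρ²/(1 − 2M/ρ)`. [folklore] -/
theorem strRadius_sq (hM : 0 ≤ M) (hρ : 2 * M < ρ) :
    strRadius M ρ ^ 2 = ρ ^ 2 / (1 - 2 * M / ρ) := by
  rw [eq_div_iff (one_sub_pos hM hρ).ne', strRadius_sq_mul hM hρ]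

/-- `y > 0`. [folklore] -/
theorem strRadius_pos (hM : 0 ≤ M) (hρ : 2 * M < ρ) : 0 < strRadius M ρ := by
  unfold strRadius
  have hρ0 : 0 < ρ := by linarith
  exact div_pos hρ0 (sqrt_one_sub_sq hM hρ).2

/-- `ρ ≤ y` (since `√(1 − 2M/ρ) ≤ 1`). [folklore] -/
theorem le_strRadius (hM : 0 ≤ M) (hρ : 2 * M < ρ) : ρ ≤ strRadius M ρ := by
  obtain ⟨ht2, ht⟩ := sqrt_one_sub_sq hM hρ
  unfold strRadius
  set t := Real.sqrt (1 - 2 * M / ρ)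
  have hρ0 : 0 < ρ := by linarith
  have hw : 0 ≤ 2 * M / ρ := div_nonneg (by linarith) hρ0.le
  have ht1 : t ≤ 1 := by nlinarith [sq_nonneg (t - 1)]
  rw [le_div_iff₀ ht]
  nlinarith

/-- **The potential in the straightening variable**:
`V_{s,ℓ}(ρ) = ℓ(ℓ+1)/y² + b`. [folklore] -/
theorem rwPotential_eq_strRadius (hM : 0 ≤ M) (hρ : 2 * M < ρ) (s ℓ : ℕ) :
    rwPotential M s ℓ ρ = (ℓ : ℝ) * ((ℓ : ℝ) + 1) / strRadius M ρ ^ 2 + strSource M s ρ := by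
  have hy2 : strRadius M ρ ^ 2 ≠ 0 := (pow_pos (strRadius_pos hM hρ) 2).ne'
  have hρ0 : (0 : ℝ) < ρ := by linarith
  have key : (ℓ : ℝ) * ((ℓ : ℝ) + 1) / strRadius M ρ ^ 2 =
      (1 - 2 * M / ρ) * ((ℓ : ℝ) * ((ℓ : ℝ) + 1) / ρ ^ 2) := by
    rw [div_eq_iff hy2, mul_comm (1 - 2 * M / ρ), mul_assoc, mul_comm (1 - 2 * M / ρ),
      strRadius_sq_mul hM hρ]
    field_simp
  rw [key]
  unfold rwPotential strSource
  ring

/-- `b · y² = (1 − s²) · 2M/ρ` (the source is `O(M/ρ)` relative to `1/y²`). [folklore] -/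
theorem strSource_mul_sq (hM : 0 ≤ M) (hρ : 2 * M < ρ) (s : ℕ) :
    strSource M s ρ * strRadius M ρ ^ 2 = (1 - (s : ℝ) ^ 2) * (2 * M) / ρ := by
  have hρ0 : (0 : ℝ) < ρ := by linarith
  unfold strSource
  calc (1 - 2 * M / ρ) * ((1 - (s : ℝ) ^ 2) * (2 * M) / ρ ^ 3) * strRadius M ρ ^ 2
        = ((1 - (s : ℝ) ^ 2) * (2 * M) / ρ ^ 3) * (strRadius M ρ ^ 2 * (1 - 2 * M / ρ)) := by ring
    _ = ((1 - (s : ℝ) ^ 2) * (2 * M) / ρ ^ 3) * ρ ^ 2 := by rw [strRadius_sq_mul hM hρ]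
    _ = (1 - (s : ℝ) ^ 2) * (2 * M) / ρ := by field_simp

/-- `|b| · y² ≤ 6M/ρ` for `s ≤ 2`. [folklore] -/
theorem abs_strSource_mul_sq_le (hM : 0 ≤ M) (hρ : 2 * M < ρ) {s : ℕ} (hs : s ≤ 2) :
    |strSource M s ρ| * strRadius M ρ ^ 2 ≤ 6 * M / ρ := by
  have hρ0 : (0 : ℝ) < ρ := by linarith
  have hy2 : 0 ≤ strRadius M ρ ^ 2 := sq_nonneg _
  rw [← abs_of_nonneg hy2, ← abs_mul, strSource_mul_sq hM hρ]
  have hs' : (s : ℝ) ≤ 2 := by exact_mod_cast hs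
  have hs0 : (0 : ℝ) ≤ s := Nat.cast_nonneg s
  have h1 : |1 - (s : ℝ) ^ 2| ≤ 3 := by
    rw [abs_le]; constructor <;> nlinarith
  rw [abs_div, abs_of_pos hρ0, abs_mul, abs_of_nonneg (by linarith : (0 : ℝ) ≤ 2 * M)]
  apply div_le_div_of_nonneg_right _ hρ0.le
  nlinarith

/-- **Derivative of `y` in the area radius**: `dy/dρ = (1 − 3M/ρ)/(√(1 − 2M/ρ))³`. [folklore] -/
theorem hasDerivAt_strRadius (hM : 0 ≤ M) (hρ : 2 * M < ρ) :
    HasDerivAt (strRadius M) ((1 - 3 * M / ρ) / (Real.sqrt (1 - 2 * M / ρ)) ^ 3) ρ := by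
  have hρ0 : (0 : ℝ) < ρ := by linarith
  have hf := one_sub_pos hM hρ
  obtain ⟨ht2, ht⟩ := sqrt_one_sub_sq hM hρ
  -- f(ρ) = 1 − 2M/ρ has derivative 2M/ρ²
  have hfd : HasDerivAt (fun ρ => 1 - 2 * M / ρ) (2 * M / ρ ^ 2) ρ := by
    have h := ((hasDerivAt_id ρ).inv hρ0.ne').const_mul (2 * M) |>.const_sub 1
    refine h.congr_deriv ?_
    simp only [id]
    field_simp
  have hsqd : HasDerivAt (fun ρ => Real.sqrt (1 - 2 * M / ρ))
      (2 * M / ρ ^ 2 / (2 * Real.sqrt (1 - 2 * M / ρ))) ρ := hfd.sqrt hf.ne'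
  have h := (hasDerivAt_id ρ).fun_div hsqd ht.ne'
  unfold strRadius
  refine h.congr_deriv ?_
  simp only [id]
  set t := Real.sqrt (1 - 2 * M / ρ) with ht_def
  have htne : t ≠ 0 := ht.ne'
  have hρne : ρ ≠ 0 := hρ0.ne'
  have e1 : (1 * t - ρ * (2 * M / ρ ^ 2 / (2 * t))) / t ^ 2 = (t ^ 2 - M / ρ) / t ^ 3 := by
    field_simp
  have e2 : (1 - 3 * M / ρ) / t ^ 3 = (t ^ 2 - M / ρ) / t ^ 3 := by
    rw [ht2]
    ring
  rw [e1, e2]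

/-- **Along the tortoise line `dy/dx = 1 − ε`.** For a tortoise radius function `r`
(`dr/dx = 1 − 2M/r`, `r > 2M`), `y ∘ r` has derivative `1 − strDefect M (r x)` at every `x`.
[folklore] -/
theorem hasDerivAt_strRadius_comp {r : ℝ → ℝ} {xc : ℝ} (h : IsTortoiseRadius M r xc) (x : ℝ) :
    HasDerivAt (fun x => strRadius M (r x)) (1 - strDefect M (r x)) x := by
  have hM := h.mass_pos.le
  have hρ := h.two_mul_lt x
  have hρ0 : (0 : ℝ) < r x := h.pos x
  have hf := one_sub_pos hM hρ
  obtain ⟨ht2, ht⟩ := sqrt_one_sub_sq hM hρ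
  have hc := (hasDerivAt_strRadius hM hρ).comp x (h.hasDerivAt x)
  refine hc.congr_deriv ?_
  unfold strDefect
  set t := Real.sqrt (1 - 2 * M / r x) with ht_def
  have ht3 : t ^ 3 = (1 - 2 * M / r x) * t := by rw [pow_succ, ht2]
  have htne : t ≠ 0 := ht.ne'
  have hrne : r x ≠ 0 := hρ0.ne'
  have hfne : 1 - 2 * M / r x ≠ 0 := hf.ne'
  have h2ne : r x - M * 2 ≠ 0 := ne_of_gt (by linarith)
  have e1 : (1 - 3 * M / r x) / t ^ 3 * (1 - 2 * M / r x) = (1 - 3 * M / r x) / t := by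
    rw [ht3]
    field_simp
  rw [e1]
  ring

end basic

section defect

variable {M ρ : ℝ}

/-- **`ε > 0` on `ρ ≥ 3M`** (indeed on `ρ > 9M/4`). [folklore] -/
theorem strDefect_pos (hM : 0 < M) (hρ : 3 * M ≤ ρ) : 0 < strDefect M ρ := by
  have hρ0 : 0 < ρ := by linarith
  obtain ⟨ht2, ht⟩ := sqrt_one_sub_sq hM.le (by linarith : 2 * M < ρ)
  unfold strDefect
  set t := Real.sqrt (1 - 2 * M / ρ) with ht_def
  -- w := M/ρ ∈ (0, 1/3]
  have hw : M / ρ ≤ 1 / 3 := by rw [div_le_iff₀ hρ0]; linarith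
  have hw0 : 0 < M / ρ := div_pos hM hρ0
  have h2 : 2 * M / ρ = 2 * (M / ρ) := by ring
  have h3 : 3 * M / ρ = 3 * (M / ρ) := by ring
  rw [h2] at ht2
  rw [h3, _root_.sub_pos, div_lt_one ht]
  set w := M / ρ
  -- (1 − 3w) < t with t² = 1 − 2w
  nlinarith [sq_nonneg (t - 1), ht2]

/-- **`ε ≤ 1` on `ρ ≥ 3M`** (`ε = 1` exactly at the photon sphere). [folklore] -/
theorem strDefect_le_one (hM : 0 < M) (hρ : 3 * M ≤ ρ) : strDefect M ρ ≤ 1 := by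
  have hρ0 : 0 < ρ := by linarith
  obtain ⟨_, ht⟩ := sqrt_one_sub_sq hM.le (by linarith : 2 * M < ρ)
  unfold strDefect
  have h13 : 0 ≤ 1 - 3 * M / ρ := by
    rw [sub_nonneg, div_le_one hρ0]; linarith
  have : 0 ≤ (1 - 3 * M / ρ) / Real.sqrt (1 - 2 * M / ρ) := div_nonneg h13 ht.le
  linarith

/-- **Lower bound `2M/ρ ≤ ε`** on `ρ ≥ 3M`. [folklore] -/
theorem strDefect_ge (hM : 0 < M) (hρ : 3 * M ≤ ρ) : 2 * M / ρ ≤ strDefect M ρ := by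
  have hρ0 : 0 < ρ := by linarith
  obtain ⟨ht2, ht⟩ := sqrt_one_sub_sq hM.le (by linarith : 2 * M < ρ)
  unfold strDefect
  set t := Real.sqrt (1 - 2 * M / ρ) with ht_def
  have hw : M / ρ ≤ 1 / 3 := by rw [div_le_iff₀ hρ0]; linarith
  have hw0 : 0 < M / ρ := div_pos hM hρ0
  have h2 : 2 * M / ρ = 2 * (M / ρ) := by ring
  have h3 : 3 * M / ρ = 3 * (M / ρ) := by ring
  rw [h2] at ht2 ⊢
  rw [h3]
  set w := M / ρ
  -- goal: 2w ≤ 1 − (1 − 3w)/t  ⟺  (1 − 3w) ≤ (1 − 2w) t = t³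
  rw [le_sub_iff_add_le, add_comm, ← le_sub_iff_add_le, div_le_iff₀ ht]
  have ht1 : t ≤ 1 := by nlinarith [sq_nonneg (t - 1)]
  -- t³ ≥ 1 − 3w ⟸ t³ − (1 − 3w): since t² = 1 − 2w, t³ = t − 2wt; need t − 2wt ≥ 1 − 3w,
  -- i.e. (1 − t)(3w − ... ) — use t ≥ 1 − w − w²  (as t² = 1−2w ≥ (1−w−w²)² needs w small) :
  nlinarith [sq_nonneg t, sq_nonneg (t - 1 + w), mul_pos ht ht, ht2, sq_nonneg w,
    mul_nonneg hw0.le (sq_nonneg (t - 1))]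

/-- **Upper bound `ε ≤ 2M/ρ + 3M²/ρ²`** on `ρ ≥ 3M` (equality at `ρ = 3M`). [folklore] -/
theorem strDefect_le (hM : 0 < M) (hρ : 3 * M ≤ ρ) :
    strDefect M ρ ≤ 2 * M / ρ + 3 * M ^ 2 / ρ ^ 2 := by
  have hρ0 : 0 < ρ := by linarith
  obtain ⟨ht2, ht⟩ := sqrt_one_sub_sq hM.le (by linarith : 2 * M < ρ)
  unfold strDefect
  set t := Real.sqrt (1 - 2 * M / ρ) with ht_def
  have hw : M / ρ ≤ 1 / 3 := by rw [div_le_iff₀ hρ0]; linarith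
  have hw0 : 0 < M / ρ := div_pos hM hρ0
  have h2 : 2 * M / ρ = 2 * (M / ρ) := by ring
  have h3 : 3 * M / ρ = 3 * (M / ρ) := by ring
  have h4 : 3 * M ^ 2 / ρ ^ 2 = 3 * (M / ρ) ^ 2 := by rw [div_pow]; ring
  rw [h2] at ht2 ⊢
  rw [h3, h4]
  set w := M / ρ
  -- goal: 1 − (1 − 3w)/t ≤ 2w + 3w² ⟺ (1 − 2w − 3w²) t ≤ 1 − 3w, and 1 − 2w − 3w² = (1 − 3w)(1 + w),
  -- so it reduces to (1 + w) t ≤ 1, i.e. (1 + w)²(1 − 2w) ≤ 1 ⟺ −3w² − 2w³ ≤ 0.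
  rw [sub_le_iff_le_add, ← sub_le_iff_le_add', le_div_iff₀ ht]
  have h13 : 0 ≤ 1 - 3 * w := by linarith
  have key : (1 + w) * t ≤ 1 := by
    nlinarith [sq_nonneg ((1 + w) * t - 1), mul_pos ht ht, sq_nonneg ((1 + w) * t + 1)]
  nlinarith [mul_nonneg h13 (by linarith : (0 : ℝ) ≤ 1 + w)]

/-- `ε < 1` strictly beyond the photon sphere, `ρ > 3M`. [folklore] -/
theorem strDefect_lt_one (hM : 0 < M) (hρ : 3 * M < ρ) : strDefect M ρ < 1 := by
  have hρ0 : 0 < ρ := by linarith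
  obtain ⟨_, ht⟩ := sqrt_one_sub_sq hM.le (by linarith : 2 * M < ρ)
  unfold strDefect
  have h13 : 0 < 1 - 3 * M / ρ := by
    rw [_root_.sub_pos, div_lt_one hρ0]; linarith
  have : 0 < (1 - 3 * M / ρ) / Real.sqrt (1 - 2 * M / ρ) := div_pos h13 ht
  linarith

/-- `y ≤ 2ρ` for `ρ ≥ 3M` (indeed `y/ρ = 1/√(1 − 2M/ρ) ≤ √3`). [folklore] -/
theorem strRadius_le_two_mul (hM : 0 < M) (hρ : 3 * M ≤ ρ) : strRadius M ρ ≤ 2 * ρ := by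
  have hρ0 : 0 < ρ := by linarith
  obtain ⟨ht2, ht⟩ := sqrt_one_sub_sq hM.le (by linarith : 2 * M < ρ)
  unfold strRadius
  set t := Real.sqrt (1 - 2 * M / ρ) with ht_def
  have hw : 2 * M / ρ ≤ 2 / 3 := by rw [div_le_iff₀ hρ0]; linarith
  have ht12 : 1 / 2 ≤ t := by nlinarith [sq_nonneg (t + 1 / 2), ht2]
  rw [div_le_iff₀ ht]
  nlinarith

end defect

section defectDeriv

variable {M ρ : ℝ}

/-- **Derivative of the defect in the area radius**:
`dε/dρ = −(M/ρ²)(2 − 3M/ρ)/(√(1 − 2M/ρ))³`. [folklore] -/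
theorem hasDerivAt_strDefect (hM : 0 ≤ M) (hρ : 2 * M < ρ) :
    HasDerivAt (strDefect M)
      (-(M / ρ ^ 2 * (2 - 3 * M / ρ) / Real.sqrt (1 - 2 * M / ρ) ^ 3)) ρ := by
  have hρ0 : (0 : ℝ) < ρ := by linarith
  have hf := one_sub_pos hM hρ
  obtain ⟨ht2, ht⟩ := sqrt_one_sub_sq hM hρ
  have hfd : HasDerivAt (fun ρ => 1 - 2 * M / ρ) (2 * M / ρ ^ 2) ρ := by
    have h := ((hasDerivAt_id ρ).inv hρ0.ne').const_mul (2 * M) |>.const_sub 1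
    refine h.congr_deriv ?_
    simp only [id]
    field_simp
  have hgd : HasDerivAt (fun ρ => 1 - 3 * M / ρ) (3 * M / ρ ^ 2) ρ := by
    have h := ((hasDerivAt_id ρ).inv hρ0.ne').const_mul (3 * M) |>.const_sub 1
    refine h.congr_deriv ?_
    simp only [id]
    field_simp
  have hsqd : HasDerivAt (fun ρ => Real.sqrt (1 - 2 * M / ρ))
      (2 * M / ρ ^ 2 / (2 * Real.sqrt (1 - 2 * M / ρ))) ρ := hfd.sqrt hf.ne'
  have h := (hgd.fun_div hsqd ht.ne').const_sub 1
  unfold strDefect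
  refine h.congr_deriv ?_
  set t := Real.sqrt (1 - 2 * M / ρ) with ht_def
  have htne : t ≠ 0 := ht.ne'
  have hρne : ρ ≠ 0 := hρ0.ne'
  have e1 : (3 * M / ρ ^ 2 * t - (1 - 3 * M / ρ) * (2 * M / ρ ^ 2 / (2 * t))) / t ^ 2 =
      (3 * M * t ^ 2 - (1 - 3 * M / ρ) * M) / (ρ ^ 2 * t ^ 3) := by
    field_simp
  have e2 : M / ρ ^ 2 * (2 - 3 * M / ρ) / t ^ 3 =
      (3 * M * t ^ 2 - (1 - 3 * M / ρ) * M) / (ρ ^ 2 * t ^ 3) := by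
    rw [ht2]
    field_simp
    ring
  rw [e1, e2]

/-- **Along the tortoise line** `dε/dx = −(M/r²)(2 − 3M/r)/√(1 − 2M/r)`. [folklore] -/
theorem hasDerivAt_strDefect_comp {r : ℝ → ℝ} {xc : ℝ} (h : IsTortoiseRadius M r xc) (x : ℝ) :
    HasDerivAt (fun x => strDefect M (r x))
      (-(M / r x ^ 2 * (2 - 3 * M / r x) / Real.sqrt (1 - 2 * M / r x))) x := by
  have hM := h.mass_pos.le
  have hρ := h.two_mul_lt x
  obtain ⟨ht2, ht⟩ := sqrt_one_sub_sq hM hρ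
  have hc := (hasDerivAt_strDefect hM hρ).comp x (h.hasDerivAt x)
  refine hc.congr_deriv ?_
  set t := Real.sqrt (1 - 2 * M / r x) with ht_def
  have ht3 : t ^ 3 = (1 - 2 * M / r x) * t := by rw [pow_succ, ht2]
  have htne : t ≠ 0 := ht.ne'
  have hfne : 1 - 2 * M / r x ≠ 0 := (one_sub_pos hM hρ).ne'
  have hrne : r x ≠ 0 := (h.pos x).ne'
  have h2ne : r x - M * 2 ≠ 0 := ne_of_gt (by linarith)
  have e1 : -(M / r x ^ 2 * (2 - 3 * M / r x) / t ^ 3) * (1 - 2 * M / r x) =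
      -(M / r x ^ 2 * (2 - 3 * M / r x) / t) := by
    rw [ht3]
    field_simp
  exact e1

/-- **`ε` decreases along the line, at a rate between `M/r²` and `4M/r²`** (for `r ≥ 3M`):
`M/r² ≤ −dε/dx ≤ 4M/r²`. [folklore] -/
theorem strDefect_comp_deriv_bounds {r : ℝ → ℝ} {xc : ℝ} (h : IsTortoiseRadius M r xc) {x : ℝ}
    (hx : 3 * M ≤ r x) :
    M / r x ^ 2 ≤ M / r x ^ 2 * (2 - 3 * M / r x) / Real.sqrt (1 - 2 * M / r x) ∧
      M / r x ^ 2 * (2 - 3 * M / r x) / Real.sqrt (1 - 2 * M / r x) ≤ 4 * M / r x ^ 2 := by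
  have hM := h.mass_pos
  have hρ := h.two_mul_lt x
  have hρ0 : 0 < r x := h.pos x
  obtain ⟨ht2, ht⟩ := sqrt_one_sub_sq hM.le hρ
  set t := Real.sqrt (1 - 2 * M / r x) with ht_def
  have hw : M / r x ≤ 1 / 3 := by rw [div_le_iff₀ hρ0]; linarith
  have hw0 : 0 < M / r x := div_pos hM hρ0
  have h3 : 3 * M / r x = 3 * (M / r x) := by ring
  have h2 : 2 * M / r x = 2 * (M / r x) := by ring
  rw [h2] at ht2
  rw [h3]
  set w := M / r x with hw_def
  have hMr2 : 0 < M / r x ^ 2 := div_pos hM (pow_pos hρ0 2)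
  -- t ∈ [1/√3, 1]: use t² ≥ 1/3 and t ≤ 1
  have ht1 : t ≤ 1 := by nlinarith [sq_nonneg (t - 1)]
  have htl : 1 / 3 ≤ t ^ 2 := by rw [ht2]; linarith
  constructor
  · -- 1 ≤ (2 − 3w)/t  since 2 − 3w ≥ 1 ≥ t
    rw [mul_div_assoc]
    have : 1 ≤ (2 - 3 * w) / t := by
      rw [le_div_iff₀ ht]; linarith
    nlinarith
  · -- (2 − 3w)/t ≤ 2/t ≤ 2√3 < 4
    rw [mul_div_assoc, show 4 * M / r x ^ 2 = M / r x ^ 2 * 4 by ring]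
    apply mul_le_mul_of_nonneg_left _ hMr2.le
    rw [div_le_iff₀ ht]
    -- 2 − 3w ≤ 4t ⟸ t ≥ 1/2 ⟸ t² ≥ 1/3
    nlinarith [sq_nonneg (t - 1 / 2)]

end defectDeriv

end ReggeWheeler

end Literature.Geometry.Lorentzian
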